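import Summits.BirchSwinnertonDyer.BirchSwinnertonDyer.Theorems.PrintCf2SplitBadTwoRestrictedSelmerCMSideConditions
import Summits.BirchSwinnertonDyer.BirchSwinnertonDyer.Theorems.PrintCf2SplitBadTwoAdditiveAtSeven
import Literature.NumberTheory.EllipticCurves.InertiaInvariantsPrimaryTorsionAdditiveProofs
import Literature.NumberTheory.EllipticCurves.EndomorphismEigenPrimaryTorsion
import Literature.NumberTheory.EllipticCurves.Agboola2007.RestrictedSelmerGroups
import HarnessLib

/-!
# Crux `PrintCf2.SplitBadTwoRankOneOfFacts` (stmt-BirchSwinnertonDyer-20368), road α v9.1 — S3c₂ piece (ii)-a: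
# file 2/2: `W*(K*_∞)` IS FINITE — the kernel of control along the `ℤ₂`-line unramified outside `v̄` is finite, unconditionally

Cell `bsd-print-cf2`, LEAD seat `bsd-line-cf2-p1` g11 (prover-bsd-line-cf2-p1-g11-0); `--supports stmt-BirchSwinnertonDyer-20368`
(helper, Theses-free). HONEST FRAMING: nothing here closes the crux or a registered stub; BSD is not proved by any of this; no summit
statement is proved by this seat. No definition, no named fact, no `sorry`.

WHAT. The registered stub S3c₂ `stub_restrictedEulerCharBottom_two` of the skeleton of record (v9.1 fc726a893a021e04) asserts the
control + bottom evaluation of Agboola's restricted Selmer group `𝔖_{v̄}(K*_∞, W*)`, `W* = ↥((W.baseChange K).endEigenPrimaryTorsion 2 π r)`,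
along THE `ℤ₂`-line `κ*` of `K` unramified outside `v̄` (`ZpExtension.IsUnramifiedOutside`). The width brick B5‴
(`hasCharValuationAt_control_identity`, `…RestrictedSelmerControlIndex`, p652120) reduced it to four indices under the side condition
`Finite (W*^{H_∞} ⧸ (γ − 1))`, `H_∞ = ker κ*`, and B5′ bounds the control kernel by `#(W*^{H_∞} ⧸ (γ − 1))`. THIS FILE DISCHARGES THAT
SIDE CONDITION for every frame of S3c₂, with no named fact:
* §1 (generic, any number field `K`, any prime `p`, any discrete `Γ_K`-module mapping equivariantly and injectively into `E[p^∞]`):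
  **if `κ` is unramified outside `𝔮` and `E/K` has ADDITIVE reduction at some finite place `w ≠ 𝔮` with `w ∤ p`, then `E[p^∞]^{ker κ}` is
  finite** — `I_w ≤ ker κ` (definition of `IsUnramifiedOutside`), and the `I_w`-fixed `p`-power torsion is killed by one integer
  (`exists_nsmul_eq_zero_of_absInertia_fixed_of_hasAdditiveReductionAt` = Silverman *ATAEC* IV.10.2(a), additive case, read on `E[p^∞]`;
  Serre–Tate §1 Lemma 2), hence lies in a finite `E[c]`: `finite_fixedPoints_kerSubgroup_geomPrimaryTorsion_of_hasAdditiveReductionAt`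
  and the CM-summand form `finite_fixedPoints_kerSubgroup_endEigenPrimaryTorsion_of_hasAdditiveReductionAt`.
* (file 1/2, `…SplitBadTwoAdditiveAtSeven`, imported): for `j(W) = −3375` and every quadratic `K`, `W_K` has ADDITIVE reduction at
  every place above `7` (`ord_w Δ = e(6a+3) ∉ 12ℤ`, Silverman *AEC* VII.5.1(c)).
* §2 (road α): for every S3c₂ frame — `K` imaginary quadratic, `v ≠ v̄` over `2`, `κ'` unramified outside `v̄`, the summand
  `↥((W.baseChange K).endEigenPrimaryTorsion 2 π r)` for ANY `π, r` (no pinning clause needed) of a member `C • W = cm7.quadraticTwist d` —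
  `W*(K*_∞) := W*^{ker κ'}` is FINITE (`finite_fixedPoints_kerSubgroup_of_frame`), and the kernel of the bottom control map
  `𝔖_{v̄}(K, W*) → 𝔖_{v̄}(K*_∞, W*)` is finite with `# ≤ #(W*^{ker κ'} ⧸ (γ' − 1)) ≤ #W*(K*_∞)` (`natCard_ker_resOfLe_le_top_le` = B5′
  at `n = 0` with the cardinal bound transported to the bottom; `finite_ker_control_of_frame`).
RELATION TO p653109 (`…RestrictedSelmerCMSideConditions`, width seat -w7, landed while this was written): that file proves the WEAKER
side condition `Finite (W*^{H_∞} ⧸ (γ − 1))` for ANY `ℤ_p`-line (kernel of `γ − 1` ⊆ Mordell–Weil torsion + pigeonhole) and removes it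
from B5‴; the present file proves that `W*^{H_∞}` ITSELF is finite on the line of record — Agboola's actual hypothesis "`W*(K*_∞)` is
finite" (Prop. 3.2, there from the formal group at a GOOD ordinary `𝔭`; here from the additive place above `7`, inside the unramified
set of `K*_∞`), which is what bounds the control kernel by a FRAME-INDEPENDENT quantity (`#W*(K*_∞) ≤ #E[c]`). presearch: Agboola 2007 §3 Prop. 3.2 (arXiv:math/0602192 p0008), Greenberg LNM 1716 Lemma 3.1,
Silverman ATAEC IV.10.2(a) — all held; no new fact filed.

References: [Agboola2007] §3 Prop. 3.2; [GreenbergLNM1716] §3 Lemma 3.1; [SilvermanATAEC1994] Thm. IV.10.2(a) and App. A §3;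
[SilvermanAEC2009] VII.5 Prop. 5.1(c), X.5 Prop. 5.4; [SerreTate1968] §1 Lemma 2.
-/

noncomputable section

open scoped Classical

set_option linter.dupNamespace false
set_option autoImplicit false

open NumberField IsDedekindDomain Field WeierstrassCurve
open Literature.NumberTheory.EllipticCurves Literature.NumberTheory.EllipticCurves.GreenbergSelmer
open Literature.NumberTheory.EllipticCurves.Agboola2007
open Literature.NumberTheory.EllipticCurves.IwasawaDual
open Literature.NumberTheory.EllipticCurves.ResKernel
open Literature.NumberTheory.GaloisRepresentations

universe u

namespace Summit.BirchSwinnertonDyer.BirchSwinnertonDyer.Theorems.PrintCf2.RestrictedSelmerPair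

/-! ## §1. `E[p^∞]^{ker κ}` is finite when `κ` is unramified outside `𝔮` and `E` has an additive place `w ≠ 𝔮`, `w ∤ p` -/

section Generic

variable {K : Type u} [Field K] [NumberField K] {p : ℕ} [Fact p.Prime]

/-- **Inertia at an unramified place of the line fixes the `H_∞`-invariants**: if `κ` is unramified outside `𝔮` and
`w ≠ 𝔮`, every local inertia element at `w` (through `res : Γ_{K_w} → Γ_K`) fixes every `m ∈ M^{ker κ}`.
[cite: Agboola2007, §1 p. 1 (arXiv p0003:L9–11)] -/
theorem smul_eq_self_of_mem_absInertia_of_isUnramifiedOutside (κ : ZpExtension K p)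
    {𝔮 w : HeightOneSpectrum (𝓞 K)} (hκ : κ.IsUnramifiedOutside 𝔮) (hw : w ≠ 𝔮)
    {M : Type u} [AddCommGroup M] [DistribMulAction (absoluteGaloisGroup K) M]
    {m : M} (hm : m ∈ FixedPoints.addSubgroup κ.kerSubgroup M)
    {σ : absoluteGaloisGroup (w.adicCompletion K)} (hσ : σ ∈ absInertia (w.adicCompletion K)) :
    absGaloisRestrict K (w.adicCompletion K) σ • m = m := by
  have hmem : absGaloisRestrict K (w.adicCompletion K) σ ∈ κ.kerSubgroup :=
    hκ w hw (Subgroup.mem_map.mpr ⟨σ, hσ, rfl⟩)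
  exact hm ⟨_, hmem⟩

/-- **`E[p^∞]^{ker κ}` is finite** for a `ℤ_p`-extension `κ` unramified outside `𝔮` of a number field `K` and an elliptic
curve `E/K` with ADDITIVE reduction at a finite place `w ≠ 𝔮`, `w ∤ p`: `I_w ≤ ker κ`, and the `I_w`-fixed `p`-power torsion is
killed by a single `c ≠ 0` (Silverman *ATAEC* IV.10.2(a), additive case, on `E[p^∞]`), so `E[p^∞]^{ker κ} ↪ E[c]`.
[cite: SilvermanATAEC1994, Thm. IV.10.2(a), additive case (PDF pp. 358–359)] [cite: GreenbergLNM1716, §3 Lemma 3.1]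
[cite: Agboola2007, §3 Prop. 3.2] -/
theorem finite_fixedPoints_kerSubgroup_geomPrimaryTorsion_of_hasAdditiveReductionAt
    (W : WeierstrassCurve K) [W.IsElliptic] (κ : ZpExtension K p) {𝔮 w : HeightOneSpectrum (𝓞 K)}
    (hκ : κ.IsUnramifiedOutside 𝔮) (hw : w ≠ 𝔮) (hwp : ((p : ℕ) : 𝓞 K) ∉ w.asIdeal)
    (hadd : W.HasAdditiveReductionAt w) :
    Finite (FixedPoints.addSubgroup κ.kerSubgroup (W.geomPrimaryTorsion p)) := by
  obtain ⟨c, hc, hkill⟩ := W.exists_nsmul_eq_zero_of_absInertia_fixed_of_hasAdditiveReductionAt p hwp hadd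
  haveI : Finite (geomTorsion W (c : ℤ)) := W.finite_geomTorsion_natCast hc
  let f : FixedPoints.addSubgroup κ.kerSubgroup (W.geomPrimaryTorsion p) → geomTorsion W (c : ℤ) :=
    fun x ↦ ⟨((x : W.geomPrimaryTorsion p) : geomPoints W), by
      rw [W.mem_geomTorsion_iff, natCast_zsmul]
      obtain ⟨n, hn⟩ := (AddCommGroup.mem_primaryComponent).mp (x : W.geomPrimaryTorsion p).2
      refine hkill _ (fun σ hσ ↦ ?_) n hn
      have h := smul_eq_self_of_mem_absInertia_of_isUnramifiedOutside κ hκ hw x.2 hσ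
      have h' := congrArg (fun y : W.geomPrimaryTorsion p ↦ (y : geomPoints W)) h
      simpa only [primaryComponent.coe_smul] using h'⟩
  have hf : Function.Injective f := fun a b hab ↦ by
    have h1 := congrArg Subtype.val hab
    exact Subtype.ext (Subtype.ext h1)
  exact Finite.of_injective f hf

/-- **The CM-summand form**: for ANY `K`-rational endomorphism `π` and `r ∈ ℤ_p`, the `ker κ`-invariants of the summand
`↥(W.endEigenPrimaryTorsion p π r) ≤ E[p^∞]` are finite under the same hypotheses (they embed into `E[p^∞]^{ker κ}`).
[cite: Agboola2007, §3 Prop. 3.2 (`W*(K*_∞)`)] [cite: SilvermanATAEC1994, Thm. IV.10.2(a)] -/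
theorem finite_fixedPoints_kerSubgroup_endEigenPrimaryTorsion_of_hasAdditiveReductionAt
    (W : WeierstrassCurve K) [W.IsElliptic] (π : W.endRing) (r : ℤ_[p]) (κ : ZpExtension K p)
    {𝔮 w : HeightOneSpectrum (𝓞 K)} (hκ : κ.IsUnramifiedOutside 𝔮) (hw : w ≠ 𝔮)
    (hwp : ((p : ℕ) : 𝓞 K) ∉ w.asIdeal) (hadd : W.HasAdditiveReductionAt w) :
    Finite (FixedPoints.addSubgroup κ.kerSubgroup ↥(W.endEigenPrimaryTorsion p π r)) := by
  haveI := finite_fixedPoints_kerSubgroup_geomPrimaryTorsion_of_hasAdditiveReductionAt W κ hκ hw hwp hadd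
  let f : FixedPoints.addSubgroup κ.kerSubgroup ↥(W.endEigenPrimaryTorsion p π r) →
      FixedPoints.addSubgroup κ.kerSubgroup (W.geomPrimaryTorsion p) :=
    fun x ↦ ⟨((x : ↥(W.endEigenPrimaryTorsion p π r)) : W.geomPrimaryTorsion p), fun τ ↦ by
      have h := x.2 τ
      exact congrArg Subtype.val h⟩
  have hf : Function.Injective f := fun a b hab ↦ by
    have h1 := congrArg Subtype.val hab
    exact Subtype.ext (Subtype.ext h1)
  exact Finite.of_injective f hf

end Generic

/-! ## §2. Road α: `W*(K*_∞)` is finite for EVERY S3c₂ frame; the control kernel is finite; B5‴ without its side condition -/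

section Frame

open Summit.BirchSwinnertonDyer.BirchSwinnertonDyer.Theorems.PrintCf2.AdditiveAtSeven

variable {K : Type} [Field K] [NumberField K]

/-- **`W*(K*_∞)` IS FINITE for every S3c₂ frame** (member `C • W = cm7^{(d)}`, `K` imaginary quadratic, `v̄ ∣ 2`, `κ'`
unramified outside `v̄`, the summand `W* = ↥((W.baseChange K).endEigenPrimaryTorsion 2 π r)` for ANY `π, r` — no pinning clause):
the `ker κ'`-fixed part of `W*` is finite, because the place of `K` above `7` is additive for `W_K` (§2), unramified in `K*_∞/K`
and prime to `2` (§1). Agboola's `W*(K*_∞)` finite (Prop. 3.2, there from the formal group at a good ordinary `𝔭`) at the additive `2`.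
[cite: Agboola2007, §3 Prop. 3.2 (arXiv p0008:L128–135)] [cite: SilvermanATAEC1994, Thm. IV.10.2(a)] -/
theorem finite_fixedPoints_kerSubgroup_of_frame {d : ℤ} (hd0 : d ≠ 0) (W : WeierstrassCurve ℚ) [W.IsElliptic]
    (C : VariableChange ℚ) (hC : C • W = cm7.quadraticTwist (d : ℚ)) (hK : IsImaginaryQuadratic K)
    (vbar : HeightOneSpectrum (𝓞 K)) (hvbar : ((2 : ℕ) : 𝓞 K) ∈ vbar.asIdeal)
    (π : (W.baseChange K).endRing) (r : ℤ_[2]) (κ' : ZpExtension K 2) (hκ' : κ'.IsUnramifiedOutside vbar) :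
    Finite (FixedPoints.addSubgroup κ'.kerSubgroup ↥((W.baseChange K).endEigenPrimaryTorsion 2 π r)) := by
  obtain ⟨w, h7⟩ := exists_heightOneSpectrum_natCast_mem (K := K) (q := 7) (by norm_num)
  have h2w : ((2 : ℕ) : 𝓞 K) ∉ w.asIdeal := natCast_two_notMem_of_seven_mem w h7
  have hw : w ≠ vbar := fun h ↦ h2w (h ▸ hvbar)
  haveI : (W.baseChange K).IsElliptic := by rw [baseChange]; infer_instance
  exact finite_fixedPoints_kerSubgroup_endEigenPrimaryTorsion_of_hasAdditiveReductionAt (W.baseChange K) π r κ' hκ' hw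
    h2w (hasAdditiveReductionAt_baseChange_of_j_eq_cm7_of_finrank_eq_two K w hK.1 W (j_eq_of_smul_eq_cm7Twist hd0 W C hC) h7)

/-- **The kernel of the bottom restriction `H¹(K, W*) → H¹(K*_∞, W*)` is finite with `# ≤ #(W*^{ker κ'} ⧸ (γ' − 1))`**
(generic: any `ℤ_p`-line, any discrete module with continuous orbit maps and `M^{H_∞}/(γ − 1)` finite; B5′
`finite_ker_resOfLe_and_card_le` at `n = 0` transported along `H¹(⊤, M) ≅ H¹(H_0, M)`).
[cite: GreenbergLNM1716, §3 Lemma 3.1 (p. 86)] -/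
theorem natCard_ker_resOfLe_le_top_le {L : Type u} [Field L] [NumberField L] {p : ℕ} [Fact p.Prime]
    (κ : ZpExtension L p) (M : Type u) [AddCommGroup M] [DistribMulAction (absoluteGaloisGroup L) M]
    [TopologicalSpace M] [DiscreteTopology M] {γ : absoluteGaloisGroup L} (hγ : κ.IsTopGenerator γ)
    (hcont : ∀ m : M, Continuous fun g : absoluteGaloisGroup L ↦ g • m)
    [hfin : Finite (FixedPoints.addSubgroup κ.kerSubgroup M ⧸ (subOne κ.kerSubgroup M γ).range)] :
    Finite (resOfLe M (le_top : κ.kerSubgroup ≤ ⊤)).ker ∧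
      Nat.card (resOfLe M (le_top : κ.kerSubgroup ≤ ⊤)).ker ≤
        Nat.card (FixedPoints.addSubgroup κ.kerSubgroup M ⧸ (subOne κ.kerSubgroup M γ).range) := by
  haveI : Finite (FixedPoints.addSubgroup κ.kerSubgroup M ⧸
      (subOne κ.kerSubgroup M (γ ^ p ^ 0)).range) := by
    simpa only [pow_zero, pow_one] using hfin
  obtain ⟨hK0, hle⟩ := finite_ker_resOfLe_and_card_le κ M 0 hγ hcont
  let ι : (resOfLe M (le_top : κ.kerSubgroup ≤ ⊤)).ker →
      (resOfLe M (κ.kerSubgroup_le_layerSubgroup 0)).ker := fun c ↦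
    ⟨resOfLe M (le_top : κ.layerSubgroup 0 ≤ ⊤) c, by
      rw [AddMonoidHom.mem_ker, ← AddMonoidHom.comp_apply,
        Literature.NumberTheory.EllipticCurves.resOfLe_comp_holds]
      exact c.2⟩
  have hι : Function.Injective ι := fun a b hab ↦ by
    have h1 : (ι a).1 = (ι b).1 := congrArg Subtype.val hab
    exact Subtype.ext ((resOfLe_layer_zero_leftInverse κ M).injective h1)
  haveI := hK0
  refine ⟨Finite.of_injective ι hι, (Nat.card_le_card_of_injective ι hι).trans (hle.trans (le_of_eq ?_))⟩
  simp only [pow_zero, pow_one]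

/-- `#(A ⧸ N) ≤ #A` for a finite additive group. [folklore] -/
theorem natCard_quotient_le {A : Type u} [AddCommGroup A] [Finite A] (N : AddSubgroup A) :
    Nat.card (A ⧸ N) ≤ Nat.card A :=
  Nat.le_of_dvd Nat.card_pos (N.card_quotient_dvd_card)

/-- **THE CONTROL KERNEL IS FINITE ON EVERY S3c₂ FRAME, BOUNDED BY `#W*(K*_∞)`**: for the bottom control map
`res : 𝔖_{v̄}(K, W*) → 𝔖_{v̄}(K*_∞, W*)` of Agboola's restricted Selmer groups (B5′/B5‴ currency:
`ker = 𝔖_{v̄}(K, W*) ∩ ker (H¹(K, W*) → H¹(K*_∞, W*))`), `ker` is finite and `#ker ≤ #(W*^{ker κ'} ⧸ (γ' − 1)) ≤ #W*(K*_∞)` — for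
every member, every imaginary quadratic `K`, `v̄ ∣ 2`, every `π, r`, every line `κ'` unramified outside `v̄` with generator `γ'`
(Agboola Prop. 3.2: "the kernel … is bounded by `W*(K*_∞)`", here at the additive prime).
[cite: Agboola2007, §3 Prop. 3.2 (arXiv p0008:L128–135, L197)] [cite: GreenbergLNM1716, §3 Lemma 3.1] -/
theorem finite_ker_control_of_frame {d : ℤ} (hd0 : d ≠ 0) (W : WeierstrassCurve ℚ) [W.IsElliptic]
    (C : VariableChange ℚ) (hC : C • W = cm7.quadraticTwist (d : ℚ)) (hK : IsImaginaryQuadratic K)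
    (vbar : HeightOneSpectrum (𝓞 K)) (hvbar : ((2 : ℕ) : 𝓞 K) ∈ vbar.asIdeal)
    (π : (W.baseChange K).endRing) (r : ℤ_[2]) (κ' : ZpExtension K 2) (hκ' : κ'.IsUnramifiedOutside vbar)
    {γ' : absoluteGaloisGroup K} (hγ' : κ'.IsTopGenerator γ') :
    Finite ↥(restrictedSelmerBase ↥((W.baseChange K).endEigenPrimaryTorsion 2 π r) 2 vbar ⊓
        (resOfLe ↥((W.baseChange K).endEigenPrimaryTorsion 2 π r) (le_top : κ'.kerSubgroup ≤ ⊤)).ker) ∧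
      Nat.card ↥(restrictedSelmerBase ↥((W.baseChange K).endEigenPrimaryTorsion 2 π r) 2 vbar ⊓
          (resOfLe ↥((W.baseChange K).endEigenPrimaryTorsion 2 π r) (le_top : κ'.kerSubgroup ≤ ⊤)).ker) ≤
        Nat.card (FixedPoints.addSubgroup κ'.kerSubgroup ↥((W.baseChange K).endEigenPrimaryTorsion 2 π r)) := by
  set M := ↥((W.baseChange K).endEigenPrimaryTorsion 2 π r)
  haveI hF := finite_fixedPoints_kerSubgroup_of_frame hd0 W C hC hK vbar hvbar π r κ' hκ'
  haveI : Finite (FixedPoints.addSubgroup κ'.kerSubgroup M ⧸ (subOne κ'.kerSubgroup M γ').range) := inferInstance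
  haveI : (W.baseChange K).IsElliptic := by rw [baseChange]; infer_instance
  obtain ⟨hfin, hle⟩ := natCard_ker_resOfLe_le_top_le κ' M hγ'
    (continuous_smul_endEigenPrimaryTorsion (W.baseChange K) 2 π r)
  haveI := hfin
  have hinj := AddSubgroup.inclusion_injective
    (inf_le_right : restrictedSelmerBase M 2 vbar ⊓ (resOfLe M (le_top : κ'.kerSubgroup ≤ ⊤)).ker ≤ _)
  exact ⟨Finite.of_injective _ hinj,
    ((Nat.card_le_card_of_injective _ hinj).trans hle).trans (natCard_quotient_le _)⟩

end Frame

end Summit.BirchSwinnertonDyer.BirchSwinnertonDyer.Theorems.PrintCf2.RestrictedSelmerPair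

end
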